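import Mathlib
import HarnessLib
import Summits.HubbardSuperconductivity.HubbardSuperconductivity.Theorems.KLProgrammeKLRegimeSplitBundleV10
import Summits.HubbardSuperconductivity.HubbardSuperconductivity.Theorems.KLProgrammeKLRegimeSplitTwoLegMultiSlot

/-!
# Route `KLProgramme` — crux K3 `KLRegimeTwoPointLimit` (stmt-HubbardSuperconductivity-19937): the bundle
# `klPredsV11 := { klPredsV10 with twoLeg := TwoLegStepV11 }` — V10 (Δ16, Δ18, Δ19) with the two-leg slot extended by the MULTI-SLOT SIZES
# conjunct (E3a-MS) `TwoLegSizesMS` (defect «Δ-stage», seat hubbard-kl-k3c3-p2; typist hubbard-kl-k3c2-p3)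

Δ-stage (k3c3-p2, HOME/STATUS 18:29Z; HOME/hubbard-kl-k3c3-p2/DEFECT-STAGE.md; texts `…SplitTwoLegMultiSlot`).  The only `C³/C⁴` information the
V6…V10 slots give on the model-dependent two-leg pieces `ℓ_n(K)` is TIER 2 of `TwoLegSizesG`, conditioned on «`K` has no piece finer than `n`»; a
child-2 prover can then certify `FrameOK` only for frames built from FROZEN coarse pieces, which carry an `n`-independent staleness
`O(G.SL·G.S 0·U²)` above the tolerance `ctCr·|U|·Λ_n²/e₀` at every deep scale — `CtOneVolume` is not certifiable from its hypothesis block.  REPAIR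
(R-ms; engine lineage p1 g6 18:38Z «certifiable, chain-rule form»): ONE more ENGINE-OUTPUT conjunct in the two-leg slot, (E3a-MS)
`TwoLegSizesMS L M G Q R β U μ K n` — at EVERY admissible frame the scale-`n` piece splits into an own-scale piece within `twoLegBar G Q U j n`
(`j ≤ 4`) and slot-`m` pieces (`n < m ≤ nScales β`) within `msBar G Q U n · R.Gfr j · uPow j U · 4^{(j−2)m}`.  ADDITIVE (g10 18:53Z (iii)): tier 2
and every V10 text stay.

THE BUNDLE: engine / split / renorm / frame slots and the history are V10's VERBATIM (`EngineBoundsAtV7S`, `BetaSplitAtS2`, `RenormalisedAtF`,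
`FrameOK`, `histV10`; `histV11` is an ALIAS of `histV10`); `TwoLegStepV11 := TwoLegStepG histV10 ∧ TwoLegSizesMS ∧ TwoLegAngularG ∧ TwoLegVolumeRate
(histV10 ∧ TwoLegStepG histV10 ∧ TwoLegSizesMS ∧ TwoLegAngularG)` (the (E3f) comparison-volume antecedent gains the conjunct too);
`klPredsV11 := { klPredsV10 with twoLeg := TwoLegStepV11 }`; slot `rfl` lemmas; component bridges (use THESE, not raw projections:
`twoLegStepG_of_twoLegStepV11`, `twoLegSizesMS_of_twoLegStepV11`, `twoLegAngularG_of_twoLegStepV11`, `twoLegVolumeRate_of_twoLegStepV11`,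
`twoLegStepGM_of_twoLegStepV11` (k3c3-p2's packaging), `twoLegStepGA_of_twoLegStepV11` (k3c3-p3's), `twoLegStepV10_of_V11`-type DROP is NOT
available for the rate conjunct — its antecedent is stronger — but `histV10_of_histP_V11`, `histRateV11_of_histP`, `twoLegVolumeRate_apply_of_V11`
serve child 2 as before); scale `0`: engine slot = V10's.  Children of gen 3: `EngineP4 | BetaSplitP | CountertermP2 | VolumeLimitP2 | TwoPointAssemblyP3`
on `klPredsV11 klWindowC`; glue closer `KLRegimeInductionV11P4` (`…SplitGlueV11P4`).  Definitions (+ bookkeeping) only; nothing about the model.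
-/

noncomputable section

namespace Summit.HubbardSuperconductivity.HubbardSuperconductivity.Theorems.KLRegimeSplit

set_option linter.dupNamespace false -- summit = problem name (single-conjunct summit), D-0017

open Real Finset Literature.MathematicalPhysics.QuantumLattice Literature.Probability.LatticeModels
open Summit.HubbardSuperconductivity.HubbardSuperconductivity.Theorems.KLProgrammeLegKernels

section Model

variable (L M : ℕ) [NeZero L] [NeZero M]

/-- **The history of the V11 bundle** — an ALIAS of `histV10` (`BetaSplitAtS2 ∧ RenormalisedAtF ∧ EngineBoundsAtV7S`): Δ-stage does not touch
the engine slot, so the history is unchanged; all V11 texts are stated with `histV10` itself. -/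
abbrev histV11 (G : GeoConsts) (P : SplitConsts) (Q : EngConsts) (R : RenConsts) (β U μ : ℝ) : TrigPolyC4v → ℕ → Prop :=
  histV10 L M G P Q R β U μ

/-- **`TwoLegStepV11 … G P Q R K n`** := `TwoLegStepG histV10 ∧ TwoLegSizesMS ∧ TwoLegAngularG ∧ TwoLegVolumeRate (histV10 ∧ TwoLegStepG histV10 ∧
TwoLegSizesMS ∧ TwoLegAngularG)` — V10's two-leg slot with the multi-slot sizes (E3a-MS) added, both AT the slot's volume and in the (E3f)
comparison-volume antecedent.  Same slot type as `Preds.twoLeg`. -/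
def TwoLegStepV11 (G : GeoConsts) (P : SplitConsts) (Q : EngConsts) (R : RenConsts) (β U μ : ℝ) (K : TrigPolyC4v) (n : ℕ) :
    Prop :=
  TwoLegStepG L M (histV10 L M G P Q R β U μ) G P Q R β U μ K n ∧ TwoLegSizesMS L M G Q R β U μ K n ∧
    TwoLegAngularG L M G Q R β U μ K n ∧
      TwoLegVolumeRate L M
        (fun L' M' _ _ K' j => histV10 L' M' G P Q R β U μ K' j ∧
          TwoLegStepG L' M' (histV10 L' M' G P Q R β U μ) G P Q R β U μ K' j ∧ TwoLegSizesMS L' M' G Q R β U μ K' j ∧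
            TwoLegAngularG L' M' G Q R β U μ K' j)
        Q β U μ K n

end Model

/-- **`klPredsV11 : Preds`** := `{ frameOK := FrameOK, renorm := RenormalisedAtF, split := BetaSplitAtS2, engine := EngineBoundsAtV7S,
twoLeg := TwoLegStepV11 }` (= `{ klPredsV10 with twoLeg := TwoLegStepV11 }`; plan g10 19:02:59Z (3) spelling). -/
def klPredsV11 : Preds where
  frameOK := FrameOK
  renorm := fun L M _ _ β U μ K R n => RenormalisedAtF L M β U μ K R n
  split := fun L M _ _ G P Q β U μ K n => BetaSplitAtS2 L M G P Q β U μ K n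
  engine := fun L M _ _ G P Q β U μ K n => EngineBoundsAtV7S L M G P Q β U μ K n
  twoLeg := fun L M _ _ G P Q R β U μ K n => TwoLegStepV11 L M G P Q R β U μ K n

/-! ## Bookkeeping (`rfl`-level) -/

/-- V11's frame class IS V10's (`FrameOK`). -/
theorem klPredsV11_frameOK : klPredsV11.frameOK = klPredsV10.frameOK := rfl

/-- V11's renormalisation slot IS V10's (`RenormalisedAtF`). -/
theorem klPredsV11_renorm : klPredsV11.renorm = klPredsV10.renorm := rfl

/-- V11's split slot IS V10's (`BetaSplitAtS2`). -/
theorem klPredsV11_split : klPredsV11.split = klPredsV10.split := rfl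

/-- V11's engine slot IS V10's (`EngineBoundsAtV7S`). -/
theorem klPredsV11_engine : klPredsV11.engine = klPredsV10.engine := rfl

/-- V11's engine slot is `EngineBoundsAtV7S`. -/
theorem klPredsV11_engine_apply (L M : ℕ) [NeZero L] [NeZero M] (G : GeoConsts) (P : SplitConsts) (Q : EngConsts) (β U μ : ℝ)
    (K : TrigPolyC4v) (n : ℕ) : klPredsV11.engine L M G P Q β U μ K n = EngineBoundsAtV7S L M G P Q β U μ K n := rfl

/-- V11's split slot is `BetaSplitAtS2`. -/
theorem klPredsV11_split_apply (L M : ℕ) [NeZero L] [NeZero M] (G : GeoConsts) (P : SplitConsts) (Q : EngConsts) (β U μ : ℝ)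
    (K : TrigPolyC4v) (n : ℕ) : klPredsV11.split L M G P Q β U μ K n = BetaSplitAtS2 L M G P Q β U μ K n := rfl

/-- V11's two-leg slot is `TwoLegStepV11`. -/
theorem klPredsV11_twoLeg (L M : ℕ) [NeZero L] [NeZero M] (G : GeoConsts) (P : SplitConsts) (Q : EngConsts) (R : RenConsts)
    (β U μ : ℝ) (K : TrigPolyC4v) (n : ℕ) :
    klPredsV11.twoLeg L M G P Q R β U μ K n = TwoLegStepV11 L M G P Q R β U μ K n := rfl

/-- The history alias unfolds to `histV10`. -/
theorem histV11_eq (L M : ℕ) [NeZero L] [NeZero M] (G : GeoConsts) (P : SplitConsts) (Q : EngConsts) (R : RenConsts) (β U μ : ℝ) :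
    histV11 L M G P Q R β U μ = histV10 L M G P Q R β U μ := rfl

section Model

variable {L M : ℕ} [NeZero L] [NeZero M] {G : GeoConsts} {P : SplitConsts} {Q : EngConsts} {R : RenConsts} {β U μ : ℝ}
  {K : TrigPolyC4v} {n : ℕ}

/-- The «G» two-leg step is the first conjunct of the V11 two-leg slot. -/
theorem twoLegStepG_of_twoLegStepV11 (h : TwoLegStepV11 L M G P Q R β U μ K n) :
    TwoLegStepG L M (histV10 L M G P Q R β U μ) G P Q R β U μ K n := h.1

/-- (E3a-MS) is the second conjunct of the V11 two-leg slot. -/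
theorem twoLegSizesMS_of_twoLegStepV11 (h : TwoLegStepV11 L M G P Q R β U μ K n) : TwoLegSizesMS L M G Q R β U μ K n := h.2.1

/-- (E3g) is the third conjunct of the V11 two-leg slot. -/
theorem twoLegAngularG_of_twoLegStepV11 (h : TwoLegStepV11 L M G P Q R β U μ K n) : TwoLegAngularG L M G Q R β U μ K n := h.2.2.1

/-- The volume-rate conjunct (E3f) of the V11 two-leg slot, with its V11 antecedent. -/
theorem twoLegVolumeRate_of_twoLegStepV11 (h : TwoLegStepV11 L M G P Q R β U μ K n) :
    TwoLegVolumeRate L M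
      (fun L' M' _ _ K' j => histV10 L' M' G P Q R β U μ K' j ∧
        TwoLegStepG L' M' (histV10 L' M' G P Q R β U μ) G P Q R β U μ K' j ∧ TwoLegSizesMS L' M' G Q R β U μ K' j ∧
          TwoLegAngularG L' M' G Q R β U μ K' j)
      Q β U μ K n := h.2.2.2

/-- k3c3-p2's packaging: the V11 two-leg slot yields `TwoLegStepGM histV10` (= `TwoLegStepG histV10 ∧ TwoLegSizesMS`). -/
theorem twoLegStepGM_of_twoLegStepV11 (h : TwoLegStepV11 L M G P Q R β U μ K n) :
    TwoLegStepGM L M (histV10 L M G P Q R β U μ) G P Q R β U μ K n := ⟨h.1, h.2.1⟩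

/-- k3c3-p3's packaging: the V11 two-leg slot yields `TwoLegStepGA histV10` (= `TwoLegStepG histV10 ∧ TwoLegAngularG`). -/
theorem twoLegStepGA_of_twoLegStepV11 (h : TwoLegStepV11 L M G P Q R β U μ K n) :
    TwoLegStepGA L M (histV10 L M G P Q R β U μ) G P Q R β U μ K n := ⟨h.1, h.2.2.1⟩

/-- The V10 two-leg slot's first two conjuncts from V11's (the rate conjunct does NOT transfer: V11's antecedent is stronger). -/
theorem twoLegStepG_and_angular_of_twoLegStepV11 (h : TwoLegStepV11 L M G P Q R β U μ K n) :
    TwoLegStepG L M (histV10 L M G P Q R β U μ) G P Q R β U μ K n ∧ TwoLegAngularG L M G Q R β U μ K n := ⟨h.1, h.2.2.1⟩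

/-- `HistP klPredsV11` below `n` yields the V10 (= V11) history: `histV10 … K j` for every `j < n`. -/
theorem histV10_of_histP_V11 (h : HistP klPredsV11 L M G P Q R β U μ K n) : ∀ j < n, histV10 L M G P Q R β U μ K j :=
  fun j hj => ⟨(h j hj).1, (h j hj).2.1, (h j hj).2.2.1⟩

/-- `HistP klPredsV11` below `n` yields the full (E3f) antecedent of V11 at that volume. -/
theorem histRateV11_of_histP (h : HistP klPredsV11 L M G P Q R β U μ K n) :
    ∀ j < n, histV10 L M G P Q R β U μ K j ∧ TwoLegStepG L M (histV10 L M G P Q R β U μ) G P Q R β U μ K j ∧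
      TwoLegSizesMS L M G Q R β U μ K j ∧ TwoLegAngularG L M G Q R β U μ K j := fun j hj =>
  ⟨⟨(h j hj).1, (h j hj).2.1, (h j hj).2.2.1⟩, (h j hj).2.2.2.1, (h j hj).2.2.2.2.1, (h j hj).2.2.2.2.2.1⟩

/-- **V11's rate clause applies whenever the comparison volume carries the V11 history** (child 2's one-liner). -/
theorem twoLegVolumeRate_apply_of_V11 (h : TwoLegStepV11 L M G P Q R β U μ K n) (hM : Q.M0 β L ≤ M) {L' M' : ℕ} [NeZero L']
    [NeZero M'] (hL : L ≤ L') (hM' : Q.M0 β L' ≤ M') (hhist : HistP klPredsV11 L' M' G P Q R β U μ K n) (θ : ℝ) :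
    |klLocalPart L M β U μ K n θ - klLocalPart L' M' β U μ K n θ| ≤ Q.CL β n / L :=
  h.2.2.2 hM L' M' hL hM' (histRateV11_of_histP hhist) θ

end Model

end Summit.HubbardSuperconductivity.HubbardSuperconductivity.Theorems.KLRegimeSplit

end
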